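import Summits.QuantumFields.YangMills.Theorems.BalabanUVNodesN07Prop4LetterHOfThm312
import HarnessLib

/-!
# BalabanUVNodes ∕ N07 — THE (R1) ROW PROPER: [B11] (117) ∕ «Theorem 3.13 of [5]» FOR THE SCHEME's SLOT-(c) LETTER `𝒢 := frakGOfRecordAtBg128 … Gp Δ2 a hposπ hQ`
# (`‖𝔊(U₀)J‖₍₁₁₅₎ ≤ B₀·|J|₍₋₃₎`, `B₀` k-FREE) REDUCED BY NAME TO [B9] THEOREM 3.13 AS PRINTED (`B9.Thm313Printed`) AT A DEFINED RECORD INSTANCE, NODE-00 REGIME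

Track A of `YM-PLAN.md` (cell `pub-ymgap`, HUMAN RULING D-0062), DAG node **N07** = [Balaban1985Variational] («[B11]», CMP **102** (1985) 277–309); [B9] =
[Balaban1985BackgroundPropagators] (CMP **99** (1985) 389–434).  Seat `pub-ymgap-dag-n07-e` (g39): the (R1) pen (dag-lead WORDS 790 (1) ∕ director-ym №578 (2)(iv) «(R1) OPEN»);
OFFER-2 → dag-lead WORDS 799 (2) DEDUP CLEAR (the lane's word); SLOT PIN per node00-def-RR-2 g30's PRE-FILING NOTE (I.≈12990: «SOCKET ≠ LETTER» — the consumer reads the slot-(c)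
letter, and print's Thm 3.13 IS about slot (c)) and ref-G g42's READ673 ADDENDUM (slot taxonomy).  `--supports stmt-QuantumFields-27238 --as helper`; count-neutral.  Sequel of
✓`…N07Prop4LetterHOfThm312` ((ℓa-H)): same members `MemberN00 F`, same backgrounds `bgRecN00 F N R35 R36`.

REVISION v1.1 (append-only; v1 = ✓p826920 byte-identical): §4 `prop4LetterHAtRecord_of_thm312Printed_inst` — the INSTANCE-BINDER TWIN of the sequel's (ℓa-H) family theorem
✓`N07Prop4LetterHOfThm312.prop4LetterHAtRecord_of_thm312Printed` (`∀ [Fact …]` binders instead of the constants `factEta ∕ factC0 ∕ wBRec_fact`, the form §3 here uses; one line from the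
constant form, whose letter types are shallow enough to unify), WITH THE CORRECTED LABEL of that antecedent (ref-G g42 READ673 ADDENDUM FLAG-L ∕ node00-def-RR-2 g30 READ 37): def-Y's
`H1OfRecordAtBgFlat` is the SLOT-(a) `H♭ = G₀Q*(QG₀Q*)⁻¹` on `G₀ = (Δ + DRD* + aQ*Q)⁻¹` (bare Hessian; print's `G₀`, [B9] p. 421, (3.26)–(3.27)), so `B9.Thm312Printed … h1KernelRecN00 …`
displays «the (3.133)-SHAPE entry bound at slot (a) — BY THE METHOD of Thm 3.12 (the `n = 0` term of (3.130): Thm 3.3 for `G₀` + the (3.132)∕p. 422 kernel step)», NOT Thm 3.12's printed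
sentence (slots (b)∕(c)); the (R1) letter of §3 IS print's slot (c).  (The same relabel of the sequel's own docstring rides with its next content edition; 400-line cap.)

THE PRINT.  [B11] (117) p. 295: *«By Theorem 3.13 of [5] the norm max{|·|₍₋₁₎, |∇·|₍₋₂₎} of the transformation can be estimated by B₀|J|₍₋₃₎ + …»* for `𝔊 = G₁𝔓*` of (111)∕(116);
[B9] Thm 3.13 p. 426: *«If an external gauge field configuration U satisfies the regularity conditions (3.35), (3.36) for α₀ sufficiently small, then Theorems 3.3, 3.10, 3.11 hold for
the propagator 𝔊, with the exception of the inequality in (3.42) involving the covariant Laplace operator»*, and Theorem 3.3's GLOBAL clause (3.47) p. 398: *«|Gλ|_{(2+γ)}, |∇_U Gλ|_{(1+γ)},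
… ≤ B₀|λ|_{(γ)}, −4 ≤ γ ≤ 4»* — at `γ = −3`: `|𝔊J|₍₋₁₎, |∇_U𝔊J|₍₋₂₎ ≤ B₀|J|₍₋₃₎` (lit's `B9.glob_at_minus_three`), i.e. (117) with print's `B₀` («depend[s] on d and L only», pp. 423–424).
THE LETTER: def-Y's generic ✓`Node00.Prop4LetterH H b := ∀ X, ‖H X‖ ≤ b‖X‖` («[B9] (3.132)∕[B11] (117)'s `B₀`-class letter») at THE SCHEME's SLOT-(c) `𝒢`:
`H := frakGOfRecordAtBg128 F N K k Ω U₀ Gp Δ2 a hposπ hQ : NegSizeLit F N K k Ω 3 →L[ℂ] Space115Lit F N K k Ω U₀` (def-Y ✓`Node00/BgRemainderOfRecord` §5: lit's CONSTRUCTED `𝔓G₁` on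
`G₁ = (π†(Δ(U₀) + Δ⁽²⁾)π + DRD* + aQ*Q)⁻¹` — [B9] (3.128)∕(3.145)∕(3.153), [B11] (79)∕(116) — at the letters `(QOfRecord U₀, Q′♭)`, with the per-background letters `G′ =: Gp`,
`Δ⁽²⁾ =: Δ2` and the positivity `hposπ`); `RegimeTok`'s `S.𝒢 := fun _ => frakGOfRecordAtBg128 …` (`Node00/BgSchemeOfRecord` :94), so the conclusion IS the first field `hH` of lit's
`B11Eq174Chart.Regime (S.𝒢 V) …` (K0ᴬ (R-a) road).  dag-n07-w3 ✓p826470 `regimeTok_flat_ofRecord_small` serves that field per background with the EXISTENTIAL `B₀ := ‖𝔊‖` (finite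
dimension); THIS file is the UNIFORM road: one `B₀` BEFORE the member, conditional on Theorem 3.13 — no overlap (WORDS 799 (2)).  (The slot-(a) `𝔊♭ = frakGOfRecordAtBgFlat` on the
bare Hessian — print's `G₀` of [B9] p.421 — is read by NO scheme socket and is not treated.)

WHAT THIS FILE DOES.  Unlike Theorem 3.12's (3.133) (a KERNEL bound, summed in the sequel's §1–§3), Theorem 3.13's (3.47) is ALREADY AN OPERATOR-NORM clause of the schema
(`Ineq342_346_347_noLap (GG i) B₀ δ₀ U`, third conjunct: `∀ n λ γ, n ≠ 3 → −4 ≤ γ ≤ 4 → glob n U λ γ ≤ B₀·wNorm γ λ`), so the wiring is pure reading (ym3-torus precedent: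
✓`Prop7SectET3NormG.normG_row_of_t313_classTransfer`):
* §1 `geoRecGN00 F N i : B9.Geometry` — the node-00 geometry of record WITH THE ARGUMENT SORT REALISED by the currents `Loc := NegSizeLit F N K k Ω 3` (`|·|₍₋₃₎`): `supNorm J = wNorm γ J := ‖J‖`
  (at the top level `L^kη_k = 1`, so `|J|_{(γ)} = sup‖J‖` for EVERY `γ` — γ-independence is print's statement here, not a shortcut), `suppIn J y′` := «`J` vanishes off the fine bonds of the
  block `y′`»; sites ∕ scales ∕ `dist` ∕ `M` as `geoRecN00`; L² ∕ Hölder sizes and cut-offs INERT (as ✓`…N15OperatorReadout.opGeo`).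
* §2 `admSet128 a i Gp Δ2` (def-Y's admissible backgrounds `{U₀ | hposπ ∧ hQ}` at the slot-(c) Hessian, as a SET — a small head for all unifications), `frakGGlobVal … U₀ h n J`
  (the two halves `JetSup.fst ∕ snd` of the (115) norm of `frakGOfRecordAtBg128 … U₀ (Gp i U₀) (Δ2 i U₀) a h.1 h.2 J`; `norm_frakG128_eq_max`), and `frakGFamilyRecN00 F N a R35 R36 Gp Δ2 i :
  B9.KernelFamily …` — the `𝔊`-family of record for DISPLAYED per-background letter families `Gp i U`, `Δ2 i U` (print's `G′(U₀)`, `Δ⁽²⁾(U₀)`): GLOBAL entries `glob 0 U J γ :=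
  |𝔊(U)J|₍₋₁₎`, `glob 1 U J γ := |∇_U𝔊(U)J|₍₋₂₎` on `admSet128` (`0` elsewhere, where the scheme defines no `𝔊(U)`); the entries `n = 2, 3` and all local ∕ Hölder ∕ L² entries
  ((3.42)–(3.46)) INERT (`0`) — this file reads ONLY (3.47) at `γ = −3`, `n = 0, 1`; `frakGFamilyRecN00_glob_eq` (any `Fact` instances of the member serve).
* §3 ★★★ `frakGLetterAtRecord_of_thm313Printed`: `B9.Thm313Printed c35 (geoRecGN00 F N) (bgRecN00 F N R35 R36) (frakGFamilyRecN00 F N a R35 R36 Gp Δ2) HasRWExp PosDefK` (DISPLAYED;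
  any completion `HasRWExp PosDefK`) ⟹ `∃ M₄ a₀ B₀ > 0, ∀ i : MemberN00 F, M₄ ≤ Mc_i → ∀ α₀ > 0, Mc_i·α₀ ≤ a₀ → ∀ [the member's Facts], ∀ U₀ ∈ R35 ∩ R36 (i c35 α₀), ∀ hposπ hQ,
  Prop4LetterH (frakGOfRecordAtBg128 F N i.K i.k i.Ω U₀ (Gp i U₀) (Δ2 i U₀) a hposπ hQ) B₀` — (117) with print's OWN `B₀`, bound BEFORE the member: k-FREE by the quantifier order.
  N06's partner letter for the junction is the slot-(c) `CovLettersY.withSectDEAt … .GG := GGY …` (`OpsYRecordV4P`) — an identification-by-transport, def-Y ∕ N06 territory.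

HONEST FRAMING.  BY-NAME REDUCTION + bookkeeping (`max` of two norms); NOTHING of [B9] (Thm 3.13, (3.47), Sect. D) or [B11] proved — `B9.Thm313Printed` at the record instance is a
DISPLAYED hypothesis (N06's row 21; XL), `R35 ∕ R36` displayed readings; (R1) stays CONDITIONAL on them; node-00 only; the N06 ↔ record junction is the same ONE transfer as for
(ℓa-H) but at slot (c) on both sides (OpsY `GGY` at the pins ↔ `frakGOfRecordAtBg128`); (R2) untouched; K0ᴬ ⟨27238⟩ NOT closed; COUNT 8∕28 · K 1∕4 UNMOVED; one finite 𝕋⁴ programme at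
fixed ε — NOT continuum ∕ OS ∕ Clay; **the Yang–Mills mass gap is NOT proved by any of this.**  No `sorry`, no `instance`, no `notation`; standard axioms.
-/

noncomputable section
open scoped Matrix Matrix.Norms.L2Operator InnerProductSpace ComplexConjugate BigOperators
namespace Summit.QuantumFields.YangMills.BalabanUVNodes.N07FrakGLetterOfThm313

open Literature.MathematicalPhysics.QuantumFieldTheory.Balaban1983to89
open Literature.MathematicalPhysics.QuantumFieldTheory.Balaban1983to89.Node00
open T4Continuum (T4Family)
open B9SectCLatticeCarrier (Bond)
open B11Eq115Space (NegSup NegSize Space115 JetSup levWeight)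
open B11Eq111FrakG (nabla115)
open Summit.QuantumFields.YangMills.Theorems.C44IterMh (L_pow_mul_eta_real)
open Summit.QuantumFields.YangMills.BalabanUVNodes.N07Prop4LetterHOfThm312 (MemberN00 bgRecN00 blkOfBond geoRecN00 h1KernelRecN00
  prop4LetterHAtRecord_of_thm312Printed)

variable (F : T4Family) (N : ℕ) (a : ℝ)

/-! ## §1 The node-00 geometry of record with the argument sort realised by the currents `|·|₍₋₃₎` -/

/-- **THE [B9] GEOMETRY OF RECORD FOR `𝔊`, NODE-00**: sites 𝔅 := the k-bonds, every scale `= k` (`len = L^kη_k = 1`), `dist` = the `ℓ¹` torus distance of the sources, `M := Mc` — as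
`geoRecN00` — with the ARGUMENT SORT REALISED: `Loc := NegSizeLit F N K k Ω 3` (the currents `J`, print's `|·|₍₋₃₎`), `suppIn J y′` := «`J` vanishes off the fine bonds of the block
`y′`», `supNorm J = wNorm γ J := ‖J‖` (at the top level `|J|_{(γ)} = sup‖J‖` for every `γ`); L² ∕ Hölder sizes and the cut-off sort INERT (as ✓`…N15OperatorReadout.opGeo`).
[cite: Balaban1985BackgroundPropagators, Sect. A (3.39)–(3.41) pp.396–397, (3.47) p.398 (typing template); Balaban1985Variational, (115) p.294, (117) p.295] -/
@[reducible] def geoRecGN00 [Fact (0 < (F.L : ℝ))] (i : MemberN00 F) : B9.Geometry :=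
  haveI := factEta F i.K i.k
  { Site := PBond (F.P i.K) i.k
    scale := fun _ => i.k
    dist := fun y y' => (Site.tdist y.src y'.src : ℝ)
    k := i.k
    eta := (F.P i.K).eta i.k
    L := F.L
    M := i.Mc
    Loc := NegSizeLit F N i.K i.k i.Ω 3
    suppIn := fun J y' => ∀ x, blkOfBond F i.K i.k x ≠ y' → NegSup.equiv _ _ J x = 0
    suppInT := fun J y' => ∀ x, blkOfBond F i.K i.k x ≠ y' → NegSup.equiv _ _ J x = 0
    supNorm := fun J => ‖J‖
    l2Norm := fun _ => 0
    wNorm := fun _ J => ‖J‖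
    holder := fun _ _ => 0
    Cut := Unit
    cutIn := fun _ _ => True
    cutInT := fun _ _ => True
    cutH := fun _ _ => 0
    cutSup := fun _ => 0
    suppInT_of_suppIn := fun _ _ h => h
    cutInT_of_cutIn := fun _ _ h => h }

/-- `L^kη_k = 1`: every scale length of the `𝔊`-geometry of record is `1`. [cite: Balaban1987RG1, (1.1)–(1.2) p.260; Balaban1985BackgroundPropagators, (3.41) p.397] -/
theorem geoRecGN00_len [Fact (0 < (F.L : ℝ))] (i : MemberN00 F) (y : (geoRecGN00 F N i).Site) : (geoRecGN00 F N i).len y = 1 :=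
  L_pow_mul_eta_real F i.k

/-- Unfolding: the weighted argument size of the `𝔊`-geometry is the `|·|₍₋₃₎` norm, for every `γ`. [cite: Balaban1985BackgroundPropagators, (3.40)–(3.41) p.397; Balaban1985Variational, (117) p.295] -/
theorem geoRecGN00_wNorm [Fact (0 < (F.L : ℝ))] (i : MemberN00 F) (γ : ℝ) (J : (geoRecGN00 F N i).Loc) :
    (geoRecGN00 F N i).wNorm γ J = (haveI := factEta F i.K i.k; ‖(J : NegSizeLit F N i.K i.k i.Ω 3)‖) := rfl

/-! ## §2 The `𝔊`-family of record: the (3.47) global entries ARE the two halves of the (115) norm of `𝔊(U₀)J` (slot (c)) -/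

section Slot

variable {F N}
variable (i : MemberN00 F)
  (Gp : ∀ i : MemberN00 F, GaugeField (F.P i.K) 0 (SU N) →
    (B11Eq103H1Complex.SiteL2K ℂ (F.P i.K).d (fun _ => (F.P i.K).sitesPerDir 0) (c0Rec F i.K i.k) (WRec N) →ₗ[ℂ]
      B11Eq103H1Complex.SiteL2K ℂ (F.P i.K).d (fun _ => (F.P i.K).sitesPerDir 0) (c0Rec F i.K i.k) (WRec N)))
  (Δ2 : ∀ i : MemberN00 F, GaugeField (F.P i.K) 0 (SU N) →
    (B11Eq103H1Complex.BondL2K ℂ (F.P i.K).d (fun _ => (F.P i.K).sitesPerDir 0) (c0Rec F i.K i.k) (WRec N) →ₗ[ℂ]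
      B11Eq103H1Complex.BondL2K ℂ (F.P i.K).d (fun _ => (F.P i.K).sitesPerDir 0) (c0Rec F i.K i.k) (WRec N)))

/-- **def-Y's ADMISSIBLE BACKGROUNDS at the slot-(c) Hessian** (as a SET): the backgrounds `U₀` carrying the scheme's two DISPLAYED proofs at the member `i` — `hposπ` (positivity of
(110)'s `Δ_{1,a}(U₀; π†(Δ + Δ⁽²⁾)π)` at the letters `(Q(U₀), Q′♭)`, [B9] Thm 3.12's positivity clause for this slot) and `hQ` (`Q(U₀)` onto); outside it the scheme defines no `𝔊(U₀)`.
Bookkeeping (the theorem below binds `hposπ hQ` themselves; the named set keeps every unification on the small head `· ∈ admSet128 …` instead of the operator types).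
[cite: Balaban1985Variational, (110) p.294; Balaban1985BackgroundPropagators, Thm 3.12 p.421, (3.128) p.421 (bookkeeping)] -/
def admSet128 [Fact (0 < c0Rec F i.K i.k)] [Fact (∀ c, 0 < wBRec F i.K i.k c)] : Set (GaugeField (F.P i.K) 0 (SU N)) :=
  {U₀ | (∀ x, x ≠ 0 → 0 < RCLike.re ⟪x, laplaceAOfRecordAt F N i.k U₀ (hessOpOfRecord128 F N i.k U₀ (Gp i U₀) (QflatOfRecord F N i.k) (Δ2 i U₀))
      (QOfRecord F N i.k U₀) (QflatOfRecord F N i.k) a x⟫_ℂ) ∧ Function.Surjective (QOfRecord F N i.k U₀)}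

/-- **THE TWO HALVES OF THE (115) NORM OF `𝔊(U₀)J`, SLOT (c)** at an admissible background: `n = 0 ↦ |𝔊(U₀)J|₍₋₁₎` (`‖JetSup.fst‖`), `n = 1 ↦ |∇_{U₀}𝔊(U₀)J|₍₋₂₎` (`‖JetSup.snd‖`),
`n = 2, 3 ↦ 0` (the entries `|𝔊∇*_Uλ|` and the Laplacian are not read), for def-Y's `frakGOfRecordAtBg128 … U₀ (Gp i U₀) (Δ2 i U₀) a h.1 h.2`.
[cite: Balaban1985BackgroundPropagators, (3.47) p.398; Balaban1985Variational, (115) p.294, (116)–(117) p.295] -/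
def frakGGlobVal [Fact (0 < (F.L : ℝ))] [Fact (0 < (F.P i.K).eta i.k)] [Fact (0 < c0Rec F i.K i.k)] [Fact (∀ c, 0 < wBRec F i.K i.k c)]
    (U₀ : GaugeField (F.P i.K) 0 (SU N)) (h : U₀ ∈ admSet128 a i Gp Δ2) (n : Fin 4) (J : NegSizeLit F N i.K i.k i.Ω 3) : ℝ :=
  if (n : ℕ) = 0 then ‖JetSup.fst (frakGOfRecordAtBg128 F N i.K i.k i.Ω U₀ (Gp i U₀) (Δ2 i U₀) a h.1 h.2 J)‖
  else if (n : ℕ) = 1 then ‖JetSup.snd (frakGOfRecordAtBg128 F N i.K i.k i.Ω U₀ (Gp i U₀) (Δ2 i U₀) a h.1 h.2 J)‖ else 0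

/-- **`max` of the two halves is the (115) norm**: `‖𝔊(U₀)J‖₍₁₁₅₎ = max (frakGGlobVal … 0 J) (frakGGlobVal … 1 J)`. [cite: Balaban1985Variational, (115) p.294 (bookkeeping)] -/
theorem norm_frakG128_eq_max [Fact (0 < (F.L : ℝ))] [Fact (0 < (F.P i.K).eta i.k)] [Fact (0 < c0Rec F i.K i.k)] [Fact (∀ c, 0 < wBRec F i.K i.k c)]
    (U₀ : GaugeField (F.P i.K) 0 (SU N)) (h : U₀ ∈ admSet128 a i Gp Δ2) (J : NegSizeLit F N i.K i.k i.Ω 3) :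
    ‖frakGOfRecordAtBg128 F N i.K i.k i.Ω U₀ (Gp i U₀) (Δ2 i U₀) a h.1 h.2 J‖ = max (frakGGlobVal a i Gp Δ2 U₀ h 0 J) (frakGGlobVal a i Gp Δ2 U₀ h 1 J) := by
  simp only [frakGGlobVal, Fin.val_zero, Fin.val_one, one_ne_zero, if_true, if_false]
  exact JetSup.norm_def _

end Slot

open Classical in
/-- **THE `𝔊`-FAMILY OF RECORD, SLOT (c)** (`B9.KernelFamily`, REAL entries), for DISPLAYED per-background letter families `Gp i U` (print's `G′(U₀)`) and `Δ2 i U` (`Δ⁽²⁾(U₀)`):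
the GLOBAL (3.47) entries `glob n U J γ := frakGGlobVal … U h n J` (`|𝔊(U)J|₍₋₁₎`, `|∇_U𝔊(U)J|₍₋₂₎` of def-Y's slot-(c) `frakGOfRecordAtBg128`) at def-Y-ADMISSIBLE backgrounds
(`admSet128`; `0` elsewhere, where the scheme defines no `𝔊(U)`), γ-independent because every (115)-type size is the plain sup at the top level; the entries `n = 2, 3` and all local ∕
Hölder ∕ L² entries (3.42)–(3.46) are INERT (`0`) — this file reads only (3.47) at `γ = −3`, `n = 0, 1`.
[cite: Balaban1985BackgroundPropagators, (3.47) p.398, (3.128) p.421, Thm 3.13 p.426, (3.153) p.426; Balaban1985Variational, (79) p.290, (111) p.294, (116)–(117) p.295] -/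
def frakGFamilyRecN00 [Fact (0 < (F.L : ℝ))] (R35 R36 : ∀ i : MemberN00 F, ℝ → ℝ → GaugeField (F.P i.K) 0 (SU N) → Prop)
    (Gp : ∀ i : MemberN00 F, GaugeField (F.P i.K) 0 (SU N) →
      (B11Eq103H1Complex.SiteL2K ℂ (F.P i.K).d (fun _ => (F.P i.K).sitesPerDir 0) (c0Rec F i.K i.k) (WRec N) →ₗ[ℂ]
        B11Eq103H1Complex.SiteL2K ℂ (F.P i.K).d (fun _ => (F.P i.K).sitesPerDir 0) (c0Rec F i.K i.k) (WRec N)))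
    (Δ2 : ∀ i : MemberN00 F, GaugeField (F.P i.K) 0 (SU N) →
      (B11Eq103H1Complex.BondL2K ℂ (F.P i.K).d (fun _ => (F.P i.K).sitesPerDir 0) (c0Rec F i.K i.k) (WRec N) →ₗ[ℂ]
        B11Eq103H1Complex.BondL2K ℂ (F.P i.K).d (fun _ => (F.P i.K).sitesPerDir 0) (c0Rec F i.K i.k) (WRec N)))
    (i : MemberN00 F) : B9.KernelFamily (geoRecGN00 F N i) (bgRecN00 F N R35 R36 i) where
  e := fun _ _ _ _ => 0
  h1 := fun _ _ _ _ => 0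
  e4 := fun _ _ _ => 0
  h2 := fun _ _ _ _ => 0
  l2 := fun _ _ _ _ => 0
  glob := fun n U J _ =>
    haveI := factEta F i.K i.k
    haveI := factC0 F i.K i.k
    haveI := wBRec_fact F i.K i.k
    if h : U ∈ admSet128 a i Gp Δ2 then frakGGlobVal a i Gp Δ2 U h n J else 0

/-- Unfolding at an admissible background: `glob n U₀ J γ = frakGGlobVal … U₀ h n J` (any `Fact` instances; the entries do not depend on their proofs).
[cite: Balaban1985BackgroundPropagators, (3.47) p.398 (bookkeeping)] -/
theorem frakGFamilyRecN00_glob_eq [Fact (0 < (F.L : ℝ))] (R35 R36 : ∀ i : MemberN00 F, ℝ → ℝ → GaugeField (F.P i.K) 0 (SU N) → Prop)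
    (Gp : ∀ i : MemberN00 F, GaugeField (F.P i.K) 0 (SU N) →
      (B11Eq103H1Complex.SiteL2K ℂ (F.P i.K).d (fun _ => (F.P i.K).sitesPerDir 0) (c0Rec F i.K i.k) (WRec N) →ₗ[ℂ]
        B11Eq103H1Complex.SiteL2K ℂ (F.P i.K).d (fun _ => (F.P i.K).sitesPerDir 0) (c0Rec F i.K i.k) (WRec N)))
    (Δ2 : ∀ i : MemberN00 F, GaugeField (F.P i.K) 0 (SU N) →
      (B11Eq103H1Complex.BondL2K ℂ (F.P i.K).d (fun _ => (F.P i.K).sitesPerDir 0) (c0Rec F i.K i.k) (WRec N) →ₗ[ℂ]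
        B11Eq103H1Complex.BondL2K ℂ (F.P i.K).d (fun _ => (F.P i.K).sitesPerDir 0) (c0Rec F i.K i.k) (WRec N)))
    (i : MemberN00 F) [Fact (0 < (F.P i.K).eta i.k)] [Fact (0 < c0Rec F i.K i.k)] [Fact (∀ c, 0 < wBRec F i.K i.k c)]
    (U₀ : GaugeField (F.P i.K) 0 (SU N)) (h : U₀ ∈ admSet128 a i Gp Δ2) (n : Fin 4) (J : NegSizeLit F N i.K i.k i.Ω 3) (γ : ℝ) :
    (frakGFamilyRecN00 F N a R35 R36 Gp Δ2 i).glob n U₀ J γ = frakGGlobVal a i Gp Δ2 U₀ h n J := by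
  have h' : U₀ ∈ @admSet128 F N a i Gp Δ2 (factC0 F i.K i.k) (wBRec_fact F i.K i.k) := h
  unfold frakGFamilyRecN00
  dsimp only
  rw [dif_pos h']

/-! ## §3 The (R1) letter (117) from `B9.Thm313Printed` BY NAME -/

/-- ★★★ **(R1) = [B11] (117) FROM [B9] THEOREM 3.13 AS PRINTED, BY NAME, AT THE RECORD (SLOT (c), NODE-00 REGIME)** — [B11] p. 295 «By Theorem 3.13 of [5] the norm
max{|·|₍₋₁₎, |∇·|₍₋₂₎} of the transformation can be estimated by B₀|J|₍₋₃₎» as a kernel-checked implication: IF `B9.Thm313Printed c35 (geoRecGN00 F N) (bgRecN00 F N R35 R36)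
(frakGFamilyRecN00 F N a R35 R36 Gp Δ2) HasRWExp PosDefK` holds (the ∃-package `M₄ δ₀ a₀ B₀ …` BEFORE the member; ANY completion `HasRWExp PosDefK` — only the (3.47) clause at
`γ = −3`, `n = 0, 1` is read; `Gp`, `Δ2` the displayed per-background letters `G′(U₀)`, `Δ⁽²⁾(U₀)`) THEN `∃ M₄ a₀ B₀ > 0` with, for EVERY member `i` (`M₄ ≤ Mc_i`), every `0 < α₀`
(`Mc_i·α₀ ≤ a₀`), ANY positivity `Fact`s of the member (binders — the consumer's own instances serve), every `U₀` in the displayed classes `R35 ∕ R36 i c35 α₀` and every pair of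
def-Y's displayed proofs `hposπ hQ`: `Prop4LetterH (frakGOfRecordAtBg128 F N i.K i.k i.Ω U₀ (Gp i U₀) (Δ2 i U₀) a hposπ hQ) B₀`, i.e. `∀ J, ‖𝔊(U₀)J‖₍₁₁₅₎ ≤ B₀‖J‖₍₋₃₎` for
`RegimeTok`'s `S.𝒢` — (117) with PRINT's OWN `B₀`, bound BEFORE `K, k, Mc, Ω, U₀`: k-FREE by the quantifier order.  Proof: `glob_at_minus_three`'s two lines + `‖·‖₍₁₁₅₎ = max`.
DISPLAYED, not proved: Theorem 3.13 (N06's row 21, XL), `R35 ∕ R36`. [cite: Balaban1985Variational, (116)–(117) p.295, (111) p.294, (79) p.290; Balaban1985BackgroundPropagators, Thm 3.13 p.426, Thm 3.3 (3.47) p.398, (3.128) p.421, (3.35)–(3.36) p.396] -/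
theorem frakGLetterAtRecord_of_thm313Printed [Fact (0 < (F.L : ℝ))] {c35 : ℝ}
    {R35 R36 : ∀ i : MemberN00 F, ℝ → ℝ → GaugeField (F.P i.K) 0 (SU N) → Prop}
    {Gp : ∀ i : MemberN00 F, GaugeField (F.P i.K) 0 (SU N) →
      (B11Eq103H1Complex.SiteL2K ℂ (F.P i.K).d (fun _ => (F.P i.K).sitesPerDir 0) (c0Rec F i.K i.k) (WRec N) →ₗ[ℂ]
        B11Eq103H1Complex.SiteL2K ℂ (F.P i.K).d (fun _ => (F.P i.K).sitesPerDir 0) (c0Rec F i.K i.k) (WRec N))}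
    {Δ2 : ∀ i : MemberN00 F, GaugeField (F.P i.K) 0 (SU N) →
      (B11Eq103H1Complex.BondL2K ℂ (F.P i.K).d (fun _ => (F.P i.K).sitesPerDir 0) (c0Rec F i.K i.k) (WRec N) →ₗ[ℂ]
        B11Eq103H1Complex.BondL2K ℂ (F.P i.K).d (fun _ => (F.P i.K).sitesPerDir 0) (c0Rec F i.K i.k) (WRec N))}
    {HasRWExp : ∀ i : MemberN00 F, B9.KernelFamily (geoRecGN00 F N i) (bgRecN00 F N R35 R36 i) → (bgRecN00 F N R35 R36 i).Cfg → ℝ → Prop}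
    {PosDefK : ∀ i : MemberN00 F, B9.KernelFamily (geoRecGN00 F N i) (bgRecN00 F N R35 R36 i) → (bgRecN00 F N R35 R36 i).Cfg → Prop}
    (h313 : B9.Thm313Printed c35 (geoRecGN00 F N) (bgRecN00 F N R35 R36) (frakGFamilyRecN00 F N a R35 R36 Gp Δ2) HasRWExp PosDefK) :
    ∃ M₄ a₀ B₀ : ℝ, 0 < M₄ ∧ 0 < a₀ ∧ 0 < B₀ ∧
      ∀ i : MemberN00 F, M₄ ≤ (i.Mc : ℝ) → ∀ α₀ : ℝ, 0 < α₀ → (i.Mc : ℝ) * α₀ ≤ a₀ →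
        ∀ [Fact (0 < (F.P i.K).eta i.k)] [Fact (0 < c0Rec F i.K i.k)] [Fact (∀ c, 0 < wBRec F i.K i.k c)],
        ∀ U₀ : GaugeField (F.P i.K) 0 (SU N), R35 i c35 α₀ U₀ → R36 i c35 α₀ U₀ →
          ∀ (hposπ : ∀ x, x ≠ 0 → 0 < RCLike.re ⟪x, laplaceAOfRecordAt F N i.k U₀ (hessOpOfRecord128 F N i.k U₀ (Gp i U₀) (QflatOfRecord F N i.k) (Δ2 i U₀))
              (QOfRecord F N i.k U₀) (QflatOfRecord F N i.k) a x⟫_ℂ)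
            (hQ : Function.Surjective (QOfRecord F N i.k U₀)),
            Prop4LetterH (frakGOfRecordAtBg128 F N i.K i.k i.Ω U₀ (Gp i U₀) (Δ2 i U₀) a hposπ hQ) B₀ := by
  obtain ⟨M₄, δ₀, a₀, B₀, _Bβ, _Bε, _Bεβ, hM₄, _hδ₀, ha₀, hB₀, h⟩ := h313
  refine ⟨M₄, a₀, B₀, hM₄, ha₀, hB₀, fun i hM α₀ hα₀ hMa _ _ _ U₀ h35 h36 hpos hQ J => ?_⟩
  have hadm : U₀ ∈ admSet128 a i Gp Δ2 := ⟨hpos, hQ⟩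
  have hglob := (h i hM α₀ hα₀ hMa U₀ h35 h36).1.2.2
  have h0 := hglob 0 J (-3) (by decide) (by norm_num) (by norm_num)
  have h1 := hglob 1 J (-3) (by decide) (by norm_num) (by norm_num)
  rw [frakGFamilyRecN00_glob_eq F N a R35 R36 Gp Δ2 i U₀ hadm] at h0 h1
  change _ ≤ B₀ * ‖J‖ at h0 h1
  change ‖frakGOfRecordAtBg128 F N i.K i.k i.Ω U₀ (Gp i U₀) (Δ2 i U₀) a hadm.1 hadm.2 J‖ ≤ B₀ * ‖J‖
  rw [norm_frakG128_eq_max a i Gp Δ2 U₀ hadm J]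
  exact max_le h0 h1


/-! ## §4 (v1.1) The (ℓa-H) family theorem of the sequel with instance binders, label corrected (slot (a)) -/

/-- ★★ **(ℓa-H) — INSTANCE-BINDER TWIN of ✓`N07Prop4LetterHOfThm312.prop4LetterHAtRecord_of_thm312Printed`, LABEL CORRECTED**: from the DISPLAYED `B9.Thm312Printed 4 c35 (geoRecN00 F)
(bgRecN00 F N R35 R36) GD G₁ H (h1KernelRecN00 F N a R35 R36) …` — i.e. (ref-G FLAG-L ∕ RR-2 READ 37) the (3.133)-SHAPE entry bound for def-Y's SLOT-(a) `H♭ = H1OfRecordAtBgFlat`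
(`G₀Q*(QG₀Q*)⁻¹`, bare Hessian; in print the `n = 0` term of (3.130), by the METHOD of Thm 3.12, not its printed sentence) — `∃ M₄ a₀ b > 0` such that for every member, every `0 < α₀`
with `Mc_i·α₀ ≤ a₀`, ANY positivity `Fact`s of the member (binders: the consumer's own instances serve), every `U₀ ∈ R35 ∩ R36` and every `hpos hQ`:
`Prop4LetterHAtRecord F N i.K i.k i.Ω U₀ i.levB a hpos hQ b` (PT-B F7's `hH`), `b` bound BEFORE the member (k-FREE).  One line from the constant-instance form (the slot-(a) letter types
unify across instance proofs). [cite: Balaban1985Variational, (45)–(46) p.285, (103) p.293; Balaban1985BackgroundPropagators, (3.133) p.422, (3.130) p.421, (3.26)–(3.27) p.395, Thm 3.12 pp.421–424] -/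
theorem prop4LetterHAtRecord_of_thm312Printed_inst [Fact (0 < (F.L : ℝ))] {c35 : ℝ}
    {R35 R36 : ∀ i : MemberN00 F, ℝ → ℝ → GaugeField (F.P i.K) 0 (SU N) → Prop}
    {GD G₁ : ∀ i : MemberN00 F, B9.KernelFamily (geoRecN00 F i) (bgRecN00 F N R35 R36 i)}
    {H : ∀ i : MemberN00 F, B9.HKernel (geoRecN00 F i) (bgRecN00 F N R35 R36 i)}
    {HasRWExp : ∀ i : MemberN00 F, B9.KernelFamily (geoRecN00 F i) (bgRecN00 F N R35 R36 i) → (bgRecN00 F N R35 R36 i).Cfg → ℝ → Prop}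
    {HasRWExpH : ∀ i : MemberN00 F, B9.HKernel (geoRecN00 F i) (bgRecN00 F N R35 R36 i) → (bgRecN00 F N R35 R36 i).Cfg → ℝ → Prop}
    {PosDefK : ∀ i : MemberN00 F, B9.KernelFamily (geoRecN00 F i) (bgRecN00 F N R35 R36 i) → (bgRecN00 F N R35 R36 i).Cfg → Prop}
    (h312 : B9.Thm312Printed 4 c35 (geoRecN00 F) (bgRecN00 F N R35 R36) GD G₁ H (h1KernelRecN00 F N a R35 R36) HasRWExp HasRWExpH PosDefK) :
    ∃ M₄ a₀ b : ℝ, 0 < M₄ ∧ 0 < a₀ ∧ 0 < b ∧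
      ∀ i : MemberN00 F, M₄ ≤ (i.Mc : ℝ) → ∀ α₀ : ℝ, 0 < α₀ → (i.Mc : ℝ) * α₀ ≤ a₀ →
        ∀ [Fact (0 < (F.P i.K).eta i.k)] [Fact (0 < c0Rec F i.K i.k)] [Fact (∀ c, 0 < wBRec F i.K i.k c)],
        ∀ U₀ : GaugeField (F.P i.K) 0 (SU N), R35 i c35 α₀ U₀ → R36 i c35 α₀ U₀ →
          ∀ (hpos : ∀ x, x ≠ 0 → 0 < RCLike.re ⟪x, laplaceAOfRecord F N i.k U₀ (QOfRecord F N i.k U₀) (QflatOfRecord F N i.k) a x⟫_ℂ)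
            (hQ : Function.Surjective (QOfRecord F N i.k U₀)),
            Prop4LetterHAtRecord F N i.K i.k i.Ω U₀ i.levB a hpos hQ b := by
  obtain ⟨M₄, a₀, b, hM₄, ha₀, hb, h⟩ := prop4LetterHAtRecord_of_thm312Printed F N a h312
  exact ⟨M₄, a₀, b, hM₄, ha₀, hb, fun i hM α₀ hα₀ hMa _ _ _ U₀ h35 h36 hpos hQ => h i hM α₀ hα₀ hMa U₀ h35 h36 hpos hQ⟩

end Summit.QuantumFields.YangMills.BalabanUVNodes.N07FrakGLetterOfThm313
end
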